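import Mathlib
import Summits.Ventures.PercRepro2.SepSplitGen

/-!
# Gluing at a general separator, V: the typed rule for ANY split of the marks across a separator
`σ : ι → V` — one, two, three or four marks behind the separator (blind cell PercRepro2, mine-2
g48, 2026-08-29; `conjectures/MINE-2.md` M2-98)

The far-side counts of a data triple are nonnegative and copy-symmetric (`farCountS_nonneg`,
`farCountS_swap12/23/13/cyc/cyc'`), so the abstract rule `nonneg_of_orbit_sumsG` applies to the
identity `typedCount_eq_sepSplit`: **row 2′TRI holds whenever the marks split across a separator
of any size and every REALISED `S₃`-orbit sum of the glued root counts is nonnegative**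
(`typedCount_nonneg_of_sepSplit_realised`).  A far-side datum a configuration can realise is the
connectivity relation of a set partition of the separator vertices and the marks (`SDreal`, an
equivalence relation on `ι ⊕ Fin 5`; `sideData_real`), the count of a triple with an unreal
component vanishes (`farCountS_eq_zero_of_not_real`), and the rule may quantify over the REAL
triples instead (`typedCount_nonneg_of_sepSplit_real`) — a finite root-side statement.  The
two-far-mark case is named (`SepFarTwo`, `typedCount_nonneg_of_sepFarTwo_realised`): two marks
`far₁ ≠ far₂` behind the separator, the other three on the root side.  Own work; standard axioms.
-/

namespace Summit.Ventures.PercRepro2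

open UnionCluster

namespace CovForm

namespace RootBridge

open OneTyped TypedA3 Untouched TypedFactor Separated

/-! ## The far-side counts and their copy symmetries -/

section FarCounts

open Classical

variable {V : Type*} {E : Type*} {ι : Type*} [Fintype E] [DecidableEq E] {R : Type*} [Field R]
  [LinearOrder R] [IsStrictOrderedRing R]
variable (ends : E → Sym2 V) (mk : Fin 5 → V) (σ : ι → V) (VL : Set V)

/-- The far-side counts are nonnegative. -/
lemma farCountS_nonneg (A : Finset E) (z : Config E) (τ : E → ℕ) (p : Pat3S ι) :
    (0 : R) ≤ typedCount A z τ (farKS ends mk σ VL p) := by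
  refine typedCount_nonneg_of_nonneg _ _ _ fun x y w => ?_
  unfold farKS
  push_cast
  refine mul_nonneg (mul_nonneg ?_ ?_) ?_ <;> exact_mod_cast exactS_nonneg _ _

omit [LinearOrder R] [IsStrictOrderedRing R] in
/-- Copy symmetry of the far-side counts: the first two copies. -/
lemma farCountS_swap12 (A : Finset E) (z : Config E) (τ : E → ℕ) (p : Pat3S ι) :
    typedCount A z τ (farKS ends mk σ VL (p.2.1, p.1, p.2.2) : Config E → Config E → Config E → R) =
      typedCount A z τ (farKS ends mk σ VL p) := by
  rw [← typedCount_swap12 A z τ (farKS ends mk σ VL p)]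
  exact typedCount_congr' _ _ _ _ _ fun x y w => by unfold farKS; push_cast; ring

omit [LinearOrder R] [IsStrictOrderedRing R] in
/-- Copy symmetry of the far-side counts: the last two copies (types in `{1, 2}`). -/
lemma farCountS_swap23 (A : Finset E) (z : Config E) (τ : E → ℕ) (hτ : ∀ e ∈ A, τ e = 1 ∨ τ e = 2)
    (p : Pat3S ι) :
    typedCount A z τ (farKS ends mk σ VL (p.1, p.2.2, p.2.1) : Config E → Config E → Config E → R) =
      typedCount A z τ (farKS ends mk σ VL p) := by
  rw [← typedCount_swap23 A z τ hτ (farKS ends mk σ VL p)]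
  exact typedCount_congr' _ _ _ _ _ fun x y w => by unfold farKS; push_cast; ring

omit [LinearOrder R] [IsStrictOrderedRing R] in
/-- Copy symmetry of the far-side counts: the first and third copies (types in `{1, 2}`). -/
lemma farCountS_swap13 (A : Finset E) (z : Config E) (τ : E → ℕ) (hτ : ∀ e ∈ A, τ e = 1 ∨ τ e = 2)
    (p : Pat3S ι) :
    typedCount A z τ (farKS ends mk σ VL (p.2.2, p.2.1, p.1) : Config E → Config E → Config E → R) =
      typedCount A z τ (farKS ends mk σ VL p) := by
  rw [← typedCount_swap13 A z τ hτ (farKS ends mk σ VL p)]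
  exact typedCount_congr' _ _ _ _ _ fun x y w => by unfold farKS; push_cast; ring

omit [LinearOrder R] [IsStrictOrderedRing R] in
/-- Copy symmetry of the far-side counts: the cyclic shift `(p₁, p₂, p₃) ↦ (p₂, p₃, p₁)`. -/
lemma farCountS_cyc (A : Finset E) (z : Config E) (τ : E → ℕ) (hτ : ∀ e ∈ A, τ e = 1 ∨ τ e = 2)
    (p : Pat3S ι) :
    typedCount A z τ (farKS ends mk σ VL (p.2.1, p.2.2, p.1) : Config E → Config E → Config E → R) =
      typedCount A z τ (farKS ends mk σ VL p) := by
  have h1 := typedCount_swap12 A z τ (fun x y w => farKS ends mk σ VL p w y x : Config E →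
    Config E → Config E → R)
  have h2 := typedCount_swap13 A z τ hτ (farKS ends mk σ VL p : Config E → Config E → Config E → R)
  rw [← h2, ← h1]
  exact typedCount_congr' _ _ _ _ _ fun x y w => by unfold farKS; push_cast; ring

omit [LinearOrder R] [IsStrictOrderedRing R] in
/-- Copy symmetry of the far-side counts: the cyclic shift `(p₁, p₂, p₃) ↦ (p₃, p₁, p₂)`. -/
lemma farCountS_cyc' (A : Finset E) (z : Config E) (τ : E → ℕ) (hτ : ∀ e ∈ A, τ e = 1 ∨ τ e = 2)
    (p : Pat3S ι) :
    typedCount A z τ (farKS ends mk σ VL (p.2.2, p.1, p.2.1) : Config E → Config E → Config E → R) =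
      typedCount A z τ (farKS ends mk σ VL p) := by
  have h1 := typedCount_swap12 A z τ (fun x y w => farKS ends mk σ VL p x w y : Config E →
    Config E → Config E → R)
  have h2 := typedCount_swap23 A z τ hτ (farKS ends mk σ VL p : Config E → Config E → Config E → R)
  rw [← h2, ← h1]
  exact typedCount_congr' _ _ _ _ _ fun x y w => by unfold farKS; push_cast; ring

end FarCounts

/-! ## The real side data -/

section Real

open Classical

variable {V : Type*} {E : Type*} {ι : Type*} (ends : E → Sym2 V)

/-- The relation on the separator vertices and the marks encoded by a side datum. -/
def relS (p : SideData ι) : ι ⊕ Fin 5 → ι ⊕ Fin 5 → Bool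
  | Sum.inl i, Sum.inl j => p.2.2 i j
  | Sum.inl i, Sum.inr k => p.2.1 i k
  | Sum.inr k, Sum.inl i => p.2.1 i k
  | Sum.inr k, Sum.inr l => p.1 k l

/-- A side datum is REAL when its relation is the connectivity of a set partition of the separator
vertices and the marks: an equivalence relation on `ι ⊕ Fin 5`. -/
def SDreal (p : SideData ι) : Prop := Equivalence (fun a b => relS p a b = true)

/-- Every side datum of a configuration is real. -/
lemma sideData_real (mk : Fin 5 → V) (σ : ι → V) (y : Config E) :
    SDreal (sideData ends mk σ y) := by
  refine ⟨fun a => ?_, fun {a b} h => ?_, fun {a b c} h1 h2 => ?_⟩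
  · rcases a with i | k <;> simp only [relS, sideData, decide_eq_true_eq] <;> exact conn_refl _ _ _
  · rcases a with i | k <;> rcases b with j | l <;>
      simp only [relS, sideData, decide_eq_true_eq] at h ⊢ <;>
      first | exact h | exact conn_symm h
  · rcases a with i | k <;> rcases b with j | l <;> rcases c with i' | k' <;>
      simp only [relS, sideData, decide_eq_true_eq] at h1 h2 ⊢ <;>
      first
        | exact conn_trans h1 h2
        | exact conn_trans h1 (conn_symm h2)
        | exact conn_trans (conn_symm h2) h1
        | exact conn_trans (conn_symm h1) h2
        | exact conn_trans h2 (conn_symm h1)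

/-- An unreal datum never matches a real one. -/
lemma exactS_of_not_real {p q : SideData ι} (hp : ¬ SDreal p) (hq : SDreal q) : exactS p q = 0 := by
  unfold exactS
  rw [if_neg]
  rintro rfl
  exact hp hq

end Real

section RealCounts

open Classical

variable {V : Type*} {E : Type*} {ι : Type*} [Fintype E] [DecidableEq E] {R : Type*} [Field R]
variable (ends : E → Sym2 V) (mk : Fin 5 → V) (σ : ι → V) (VL : Set V)

/-- The far-side count of a triple with an unreal component vanishes. -/
lemma farCountS_eq_zero_of_not_real (A : Finset E) (z : Config E) (τ : E → ℕ) (p : Pat3S ι)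
    (hp : ¬ SDreal p.1 ∨ ¬ SDreal p.2.1 ∨ ¬ SDreal p.2.2) :
    typedCount A z τ (farKS ends mk σ VL p : Config E → Config E → Config E → R) = 0 := by
  rw [← typedCount_zero_kernel A z τ]
  refine typedCount_congr' _ _ _ _ _ fun x y w => ?_
  unfold farKS
  rcases hp with hp | hp | hp
  · rw [exactS_of_not_real hp (sideData_real ends mk σ _)]
    simp
  · rw [exactS_of_not_real hp (sideData_real ends mk σ _)]
    simp
  · rw [exactS_of_not_real hp (sideData_real ends mk σ _)]
    simp

/-- A triple with a nonzero far-side count has real components. -/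
lemma real_of_farCountS_ne_zero (A : Finset E) (z : Config E) (τ : E → ℕ) (p : Pat3S ι)
    (h : typedCount A z τ (farKS ends mk σ VL p : Config E → Config E → Config E → R) ≠ 0) :
    SDreal p.1 ∧ SDreal p.2.1 ∧ SDreal p.2.2 := by
  by_contra hc
  refine h (farCountS_eq_zero_of_not_real ends mk σ VL A z τ p ?_)
  by_cases h1 : SDreal p.1
  · by_cases h2 : SDreal p.2.1
    · by_cases h3 : SDreal p.2.2
      · exact absurd ⟨h1, h2, h3⟩ hc
      · exact Or.inr (Or.inr h3)
    · exact Or.inr (Or.inl h2)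
  · exact Or.inl h1

end RealCounts

/-! ## The rule on the realised orbits -/

section Rule

open Classical

variable {V : Type*} {E : Type*} {ι : Type*} [Fintype E] [DecidableEq E] [Fintype ι]
  [DecidableEq ι] {R : Type*} [Field R] [LinearOrder R] [IsStrictOrderedRing R]
variable (ends : E → Sym2 V) (mk : Fin 5 → V) (σ : ι → V)

/-- The `S₃`-orbit sum of the root-side counts of a data triple (the six copy permutations). -/
noncomputable def orbitRootS (side : Fin 5 → Bool) (VH : Set V) (B : Finset E) (z : Config E)
    (τ : E → ℕ) (p : Pat3S ι) : R :=
  orbitSumG (fun q => typedCount B z τ (rootKS ends mk σ side VH q)) p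

omit [LinearOrder R] [IsStrictOrderedRing R] in
/-- Pairing the far-side counts with a permuted root count gives the same sum. -/
lemma sum_far_root_permS (side : Fin 5 → Bool) (VL VH : Set V) (A B : Finset E) (z : Config E)
    (τ : E → ℕ) (f : Pat3S ι → Pat3S ι) (hf : Function.Bijective f)
    (hσ : ∀ p, typedCount A z τ
        (farKS ends mk σ VL (f p) : Config E → Config E → Config E → R) =
      typedCount A z τ (farKS ends mk σ VL p)) :
    (∑ p : Pat3S ι,
        typedCount A z τ (farKS ends mk σ VL p : Config E → Config E → Config E → R) *
          typedCount B z τ (rootKS ends mk σ side VH (f p))) =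
      ∑ p : Pat3S ι,
        typedCount A z τ (farKS ends mk σ VL p : Config E → Config E → Config E → R) *
          typedCount B z τ (rootKS ends mk σ side VH p) := by
  refine Fintype.sum_bijective f hf _ _ fun p => ?_
  rw [hσ p]

/-- **Row 2′TRI for any split of the marks across a separator of any size, from the REALISED
orbits**: it suffices that the `S₃`-orbit sums of the glued root-side counts be nonnegative on the
data triples whose far-side count is nonzero. -/
theorem typedCount_nonneg_of_sepSplit_realised {side : Fin 5 → Bool} {VL VH : Set V}
    (F : Finset E) (z : Config E) (τ : E → ℕ) (hτ : ∀ e ∈ F, τ e = 1 ∨ τ e = 2)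
    (h : SepSplit ends mk σ side VL VH F z)
    (hroot : ∀ p : Pat3S ι,
      typedCount (sideF ends VL F) z τ
          (farKS ends mk σ VL p : Config E → Config E → Config E → R) ≠ 0 →
      (0 : R) ≤ orbitRootS ends mk σ side VH (sideF ends VH F) z τ p) :
    0 ≤ typedCount F z τ
      (K3 ends (mk 0) (mk 1) (mk 2) (mk 3) (mk 4) : Config E → Config E → Config E → R) := by
  rw [typedCount_eq_sepSplit ends mk σ F z τ h]
  have hτA : ∀ e ∈ sideF ends VL F, τ e = 1 ∨ τ e = 2 :=
    fun e he => hτ e (Finset.filter_subset _ _ he)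
  refine mul_nonneg ?_ (typedCount_nonneg_of_nonneg _ _ _ fun _ _ _ => zero_le_one)
  refine nonneg_of_orbit_sumsG
    (fun p => typedCount (sideF ends VL F) z τ (farKS ends mk σ VL p))
    (fun p => typedCount (sideF ends VH F) z τ (rootKS ends mk σ side VH p))
    (fun p => farCountS_nonneg ends mk σ VL _ z τ p) ?_ ?_ ?_ ?_ ?_ hroot
  · exact sum_far_root_permS ends mk σ side VL VH _ _ z τ _
      (Function.Involutive.bijective fun _ => rfl)
      (fun p => farCountS_swap12 ends mk σ VL _ z τ p)
  · exact sum_far_root_permS ends mk σ side VL VH _ _ z τ _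
      (Function.Involutive.bijective fun _ => rfl)
      (fun p => farCountS_swap23 ends mk σ VL _ z τ hτA p)
  · exact sum_far_root_permS ends mk σ side VL VH _ _ z τ _
      (Function.Involutive.bijective fun _ => rfl)
      (fun p => farCountS_swap13 ends mk σ VL _ z τ hτA p)
  · exact sum_far_root_permS ends mk σ side VL VH _ _ z τ _
      (Function.bijective_iff_has_inverse.mpr
        ⟨fun p => (p.2.2, p.1, p.2.1), fun _ => rfl, fun _ => rfl⟩)
      (fun p => farCountS_cyc ends mk σ VL _ z τ hτA p)
  · exact sum_far_root_permS ends mk σ side VL VH _ _ z τ _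
      (Function.bijective_iff_has_inverse.mpr
        ⟨fun p => (p.2.1, p.2.2, p.1), fun _ => rfl, fun _ => rfl⟩)
      (fun p => farCountS_cyc' ends mk σ VL _ z τ hτA p)

/-- **Row 2′TRI for any split of the marks across a separator of any size, from the REAL
orbits**: it suffices that the `S₃`-orbit sums of the glued root-side counts be nonnegative on the
triples of real side data (the set partitions of the separator vertices and the marks) — a finite
root-side statement, no reference to the far-side counts. -/
theorem typedCount_nonneg_of_sepSplit_real {side : Fin 5 → Bool} {VL VH : Set V} (F : Finset E)
    (z : Config E) (τ : E → ℕ) (hτ : ∀ e ∈ F, τ e = 1 ∨ τ e = 2)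
    (h : SepSplit ends mk σ side VL VH F z)
    (hroot : ∀ p : Pat3S ι, SDreal p.1 → SDreal p.2.1 → SDreal p.2.2 →
      (0 : R) ≤ orbitRootS ends mk σ side VH (sideF ends VH F) z τ p) :
    0 ≤ typedCount F z τ
      (K3 ends (mk 0) (mk 1) (mk 2) (mk 3) (mk 4) : Config E → Config E → Config E → R) := by
  refine typedCount_nonneg_of_sepSplit_realised ends mk σ F z τ hτ h fun p hp => ?_
  obtain ⟨h1, h2, h3⟩ := real_of_farCountS_ne_zero ends mk σ VL _ z τ p hp
  exact hroot p h1 h2 h3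

/-- **Two marks behind the separator**: the split sending `far₁` and `far₂` to the far side. -/
def SepFarTwo (far₁ far₂ : Fin 5) (VL VH : Set V) (F : Finset E) (z : Config E) : Prop :=
  SepSplit ends mk σ (fun k => decide (k = far₁ ∨ k = far₂)) VL VH F z

/-- **Row 2′TRI when two marks sit behind a separator of any size, from the REALISED orbits.** -/
theorem typedCount_nonneg_of_sepFarTwo_realised {far₁ far₂ : Fin 5} {VL VH : Set V}
    (F : Finset E) (z : Config E) (τ : E → ℕ) (hτ : ∀ e ∈ F, τ e = 1 ∨ τ e = 2)
    (h : SepFarTwo ends mk σ far₁ far₂ VL VH F z)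
    (hroot : ∀ p : Pat3S ι,
      typedCount (sideF ends VL F) z τ
          (farKS ends mk σ VL p : Config E → Config E → Config E → R) ≠ 0 →
      (0 : R) ≤ orbitRootS ends mk σ (fun k => decide (k = far₁ ∨ k = far₂)) VH
        (sideF ends VH F) z τ p) :
    0 ≤ typedCount F z τ
      (K3 ends (mk 0) (mk 1) (mk 2) (mk 3) (mk 4) : Config E → Config E → Config E → R) :=
  typedCount_nonneg_of_sepSplit_realised ends mk σ F z τ hτ h hroot

end Rule

end RootBridge

end CovForm

end Summit.Ventures.PercRepro2
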